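import Mathlib
import Summits.RiemannHypothesis.RiemannHypothesis.Theorems.SoloInformedVerifiedWindow
import HarnessLib

/-!
# Split kernels for the verified-height split (handoff prove-1, ATTEMPT-15 §4.2, «V-1», part 1/2)

Solo's T42 (`SoloInformedVerifiedWindow`) and THEOREM V (`HandoffVerifiedGram`) split the
autocorrelation `K = g ⋆ g̃` of a window test by the kernel `φ = ψc ⋆ ψ̃c` of a non-negative
mollifier `ψ`.  This file redoes the RH-free half of the split (the HIGH part, read on the prime
side) for an ARBITRARY **split kernel**: a Weil test `φ` supported in `[-δ, δ]` whose transform on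
the critical line is real with values in `[0, 1]` (`IsSplitKernel φ δ`) — the only two properties
of `ψc ⋆ ψ̃c` that T42b uses — with the kernel's TRANSPARENCY `θ` on `|t| < |h|`
(`1 - Re φ̂(1/2+it) ≤ θ`) and POLAR DEFECT `p` (`‖1 - φ̂(0)‖, ‖1 - φ̂(1)‖ ≤ p`) entering as
hypotheses: `weilFunctional_highPartK_re_ge`:
`Re W(G₂) ≥ c · M_φ(g) - (W_h - W_0) θ ‖g‖₂² - 2 p e^a ‖g‖₁²` whenever
`log π + 2 S(2a + δ) + c ≤ Re ψ(1/4 + ih/2)`.  Part 2 (`HandoffVerifiedGramKernel`) adds the low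
part under `RHUpTo T₀` with the kernel's strip decay and the reduction to the near-null sampling
hypothesis.  For cosh-normalised, order-`2m`-flat kernels (ATTEMPT-15 §4.2: `φ̂ = 1 - (1 - |b̂|²)^m`,
a paper construction not formalised here) `p = 0` and `θ = (c_b δ'²(1 + h²))^m`.  Nothing in this
file bears on the truth of RH; no hypothesis on the zeros of `ζ` is used here.
-/

set_option linter.dupNamespace false

open scoped ContDiff ComplexConjugate Real Topology
open Complex MeasureTheory Set Filter Literature.NumberTheory.LFunctions
  Literature.Analysis.SpecialFunctions

namespace Summit.RiemannHypothesis.RiemannHypothesis.Theorems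

/-- A **split kernel** of radius `δ`: a Weil test `φ` supported in `[-δ, δ]` whose transform on the
critical line is real with values in `[0, 1]` (the two properties of `ψc ⋆ ψ̃c` used by T42). -/
structure IsSplitKernel (φ : ℝ → ℂ) (δ : ℝ) : Prop where
  test : IsWeilTest φ
  supp : tsupport φ ⊆ Icc (-δ) δ
  radius_nonneg : 0 ≤ δ
  line_im : ∀ t : ℝ, (weilMellin φ (1 / 2 + t * I)).im = 0
  line_nonneg : ∀ t : ℝ, 0 ≤ (weilMellin φ (1 / 2 + t * I)).re
  line_le_one : ∀ t : ℝ, (weilMellin φ (1 / 2 + t * I)).re ≤ 1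

variable {g φ : ℝ → ℂ} {a δ : ℝ}

/-- The line symbol `Φ(t) = Re φ̂(1/2 + it)` of a split kernel. -/
noncomputable def lineSymbol (φ : ℝ → ℂ) (t : ℝ) : ℝ := (weilMellin φ (1 / 2 + t * I)).re

/-- On the critical line the transform of a split kernel is the real number `Φ(t)`. -/
theorem IsSplitKernel.weilMellin_half_line (hφ : IsSplitKernel φ δ) (t : ℝ) :
    weilMellin φ (1 / 2 + t * I) = ((lineSymbol φ t : ℝ) : ℂ) := by
  apply Complex.ext
  · rw [Complex.ofReal_re, lineSymbol]
  · rw [Complex.ofReal_im]; exact hφ.line_im t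

/-- The line symbol `Φ` of a split kernel is continuous. -/
theorem IsSplitKernel.continuous_lineSymbol (hφ : IsSplitKernel φ δ) : Continuous (lineSymbol φ) := by
  unfold lineSymbol
  exact Complex.continuous_re.comp
    ((continuous_weilMellin hφ.test.1.continuous hφ.test.2).comp (by fun_prop))

/-! ### The split -/

/-- Low part `G₁ = K ⋆ φ`, `K = g ⋆ g̃` (`autoCorr`). -/
noncomputable def lowPartK (g φ : ℝ → ℂ) : ℝ → ℂ := weilConv (autoCorr g) φ

/-- High part `G₂ = K - K ⋆ φ`. -/
noncomputable def highPartK (g φ : ℝ → ℂ) : ℝ → ℂ := autoCorr g - lowPartK g φ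

/-- High density on the line `u(t) = |ĝ(1/2+it)|² (1 - Φ(t))`. -/
noncomputable def highDensityK (g φ : ℝ → ℂ) (t : ℝ) : ℝ :=
  ‖weilMellin g (1 / 2 + t * I)‖ ^ 2 * (1 - lineSymbol φ t)

/-- High mass `M_φ(g) = (2π)⁻¹ ∫ u`. -/
noncomputable def highMassK (g φ : ℝ → ℂ) : ℝ := (2 * π)⁻¹ * ∫ t, highDensityK g φ t

/-- Low density on the line `G(t) = |ĝ(1/2+it)|² Φ(t)`. -/
noncomputable def lowLineDensityK (g φ : ℝ → ℂ) (t : ℝ) : ℝ :=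
  ‖weilMellin g (1 / 2 + t * I)‖ ^ 2 * lineSymbol φ t

/-- Verified Gram form `𝒱_φ(g) = Σ_{ρ ∈ weilZeroIndex T₀} m(ρ) G(Im ρ)`. -/
noncomputable def verifiedGramK (g φ : ℝ → ℂ) (T₀ : ℝ) : ℝ :=
  ∑ᶠ ρ ∈ weilZeroIndex T₀, (riemannZetaZeroOrder ρ : ℝ) * lowLineDensityK g φ ρ.im

/-- `G(t) ≥ 0`. -/
theorem lowLineDensityK_nonneg (hφ : IsSplitKernel φ δ) (g : ℝ → ℂ) (t : ℝ) :
    0 ≤ lowLineDensityK g φ t :=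
  mul_nonneg (sq_nonneg _) (hφ.line_nonneg t)

/-- `𝒱_φ(g) ≥ 0`. -/
theorem verifiedGramK_nonneg (hφ : IsSplitKernel φ δ) (g : ℝ → ℂ) (T₀ : ℝ) :
    0 ≤ verifiedGramK g φ T₀ := by
  unfold verifiedGramK
  refine finsum_nonneg fun ρ ↦ finsum_nonneg fun hρ ↦ ?_
  have him : ρ.im ≠ 0 := hρ.2.2.2.1
  have hm0 : (0 : ℝ) ≤ riemannZetaZeroOrder ρ := by
    exact_mod_cast riemannZetaZeroOrder_nonneg (fun h ↦ him (by rw [h]; simp))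
  exact mul_nonneg hm0 (lowLineDensityK_nonneg hφ g _)

/-- `G₁` is a Weil test. -/
theorem isWeilTest_lowPartK (hg : IsWeilTest g) (hφ : IsSplitKernel φ δ) :
    IsWeilTest (lowPartK g φ) :=
  (isWeilTest_autoCorr hg).weilConv hφ.test

/-- `G₂` is a Weil test. -/
theorem isWeilTest_highPartK (hg : IsWeilTest g) (hφ : IsSplitKernel φ δ) :
    IsWeilTest (highPartK g φ) := by
  have h1 := isWeilTest_autoCorr hg
  have h2 := isWeilTest_lowPartK hg hφ
  exact ⟨h1.1.sub h2.1, h1.2.sub h2.2⟩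

/-- `G₁ + G₂ = K`. -/
theorem lowPartK_add_highPartK (g φ : ℝ → ℂ) : lowPartK g φ + highPartK g φ = autoCorr g := by
  unfold highPartK; abel

/-- `tsupport G₁ ⊆ [-(2a+δ), 2a+δ]`. -/
theorem tsupport_lowPartK_subset (hg : IsWeilTest g) (hsupp : tsupport g ⊆ Icc (-a) a)
    (hφ : IsSplitKernel φ δ) :
    tsupport (lowPartK g φ) ⊆ Icc (-(2 * a + δ)) (2 * a + δ) :=
  (tsupport_weilConv_subset (isWeilTest_autoCorr hg).2).trans
    ((add_subset_add (tsupport_autoCorr_subset hg hsupp) hφ.supp).trans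
      (by simpa [two_mul, add_assoc] using Icc_add_Icc_subset (2 * a) δ))

/-- `tsupport G₂ ⊆ [-(2a+δ), 2a+δ]`. -/
theorem tsupport_highPartK_subset (hg : IsWeilTest g) (hsupp : tsupport g ⊆ Icc (-a) a)
    (hφ : IsSplitKernel φ δ) :
    tsupport (highPartK g φ) ⊆ Icc (-(2 * a + δ)) (2 * a + δ) := by
  have hδ := hφ.radius_nonneg
  have hK : tsupport (autoCorr g) ⊆ Icc (-(2 * a + δ)) (2 * a + δ) :=
    (tsupport_autoCorr_subset hg hsupp).trans (Icc_subset_Icc (by linarith) (by linarith))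
  have hL := tsupport_lowPartK_subset hg hsupp hφ
  unfold highPartK
  refine closure_minimal ?_ isClosed_Icc
  exact (Function.support_sub _ _).trans
    (union_subset ((subset_tsupport _).trans hK) ((subset_tsupport _).trans hL))

/-! ### Transforms -/

/-- `Ĝ₁(s) = K̂(s) φ̂(s)`. -/
theorem weilMellin_lowPartK (hg : IsWeilTest g) (hφ : IsSplitKernel φ δ) (s : ℂ) :
    weilMellin (lowPartK g φ) s = weilMellin (autoCorr g) s * weilMellin φ s := by
  have hK := isWeilTest_autoCorr hg
  unfold lowPartK
  exact weilMellin_weilConv_holds hK.1.continuous hK.2 hφ.test.1.continuous hφ.test.2 s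

/-- `Ĝ₂(s) = K̂(s) (1 - φ̂(s))`. -/
theorem weilMellin_highPartK (hg : IsWeilTest g) (hφ : IsSplitKernel φ δ) (s : ℂ) :
    weilMellin (highPartK g φ) s = weilMellin (autoCorr g) s * (1 - weilMellin φ s) := by
  have hK := isWeilTest_autoCorr hg
  have hL := isWeilTest_lowPartK hg hφ
  unfold highPartK
  rw [weilMellin_sub hK.1.continuous hK.2 hL.1.continuous hL.2, weilMellin_lowPartK hg hφ]
  ring

/-- On the line `Ĝ₁(1/2+it) = G(t) = |ĝ|² Φ`. -/
theorem weilMellin_lowPartK_half_line (hg : IsWeilTest g) (hφ : IsSplitKernel φ δ) (t : ℝ) :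
    weilMellin (lowPartK g φ) (1 / 2 + t * I) = ((lowLineDensityK g φ t : ℝ) : ℂ) := by
  rw [weilMellin_lowPartK hg hφ, autoCorr, weilMellin_weilConv_weilReflect_half hg,
    hφ.weilMellin_half_line, lowLineDensityK]
  push_cast; ring

/-- On the line `Ĝ₂(1/2+it) = u(t) = |ĝ|² (1 - Φ)`. -/
theorem weilMellin_highPartK_half_line (hg : IsWeilTest g) (hφ : IsSplitKernel φ δ) (t : ℝ) :
    weilMellin (highPartK g φ) (1 / 2 + t * I) = ((highDensityK g φ t : ℝ) : ℂ) := by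
  rw [weilMellin_highPartK hg hφ, autoCorr, weilMellin_weilConv_weilReflect_half hg,
    hφ.weilMellin_half_line, highDensityK]
  push_cast; ring

/-- `0 ≤ u(t) ≤ |ĝ(1/2+it)|²`. -/
theorem highDensityK_bounds (hφ : IsSplitKernel φ δ) (g : ℝ → ℂ) (t : ℝ) :
    0 ≤ highDensityK g φ t ∧ highDensityK g φ t ≤ ‖weilMellin g (1 / 2 + t * I)‖ ^ 2 := by
  have h0 := hφ.line_nonneg t
  have h1 := hφ.line_le_one t
  unfold highDensityK lineSymbol at *
  constructor
  · exact mul_nonneg (sq_nonneg _) (by linarith)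
  · nlinarith [sq_nonneg ‖weilMellin g (1 / 2 + t * I)‖]

/-- `u` is continuous. -/
theorem continuous_highDensityK (hg : IsWeilTest g) (hφ : IsSplitKernel φ δ) :
    Continuous (highDensityK g φ) :=
  (continuous_norm_sq_weilMellin_half_line hg).mul (continuous_const.sub hφ.continuous_lineSymbol)

/-- `u` is integrable. -/
theorem integrable_highDensityK (hg : IsWeilTest g) (hφ : IsSplitKernel φ δ) :
    Integrable (highDensityK g φ) :=
  (integrable_norm_sq_weilMellin_half_line hg).mono'
    (continuous_highDensityK hg hφ).aestronglyMeasurable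
    (Eventually.of_forall fun t ↦ by
      rw [Real.norm_of_nonneg (highDensityK_bounds hφ g t).1]
      exact (highDensityK_bounds hφ g t).2)

/-- `u · Re ψ(1/4 + i·/2)` is integrable. -/
theorem integrable_highDensityK_mul_reDigammaQuarter (hg : IsWeilTest g) (hφ : IsSplitKernel φ δ) :
    Integrable fun t ↦ highDensityK g φ t * reDigammaQuarter t :=
  (integrable_norm_sq_weilMellin_mul_reDigammaQuarter hg).mono
    ((continuous_highDensityK hg hφ).aestronglyMeasurable.mul
      measurable_reDigammaQuarter.aestronglyMeasurable)
    (Eventually.of_forall fun t ↦ by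
      rw [norm_mul, Real.norm_of_nonneg (highDensityK_bounds hφ g t).1, Real.norm_eq_abs]
      calc highDensityK g φ t * |reDigammaQuarter t|
          ≤ ‖weilMellin g (1 / 2 + t * I)‖ ^ 2 * |reDigammaQuarter t| :=
            mul_le_mul_of_nonneg_right (highDensityK_bounds hφ g t).2 (abs_nonneg _)
        _ ≤ ‖‖weilMellin g (1 / 2 + t * I)‖ ^ 2 * reDigammaQuarter t‖ := by
            rw [norm_mul, Real.norm_of_nonneg (sq_nonneg _), Real.norm_eq_abs])

/-- `M_φ(g) ≥ 0`. -/
theorem highMassK_nonneg (hφ : IsSplitKernel φ δ) (g : ℝ → ℂ) : 0 ≤ highMassK g φ :=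
  mul_nonneg (by positivity) (integral_nonneg fun t ↦ (highDensityK_bounds hφ g t).1)

/-- `‖G₂(x)‖ ≤ M_φ(g)` by Mellin inversion of the non-negative line density. -/
theorem norm_highPartK_le (hg : IsWeilTest g) (hφ : IsSplitKernel φ δ) (x : ℝ) :
    ‖highPartK g φ x‖ ≤ highMassK g φ := by
  unfold highMassK
  exact norm_le_of_norm_weilMellin_line_le (isWeilTest_highPartK hg hφ)
    (integrable_highDensityK hg hφ) (fun y ↦ by
      rw [weilMellin_highPartK_half_line hg hφ, Complex.norm_real,
        Real.norm_of_nonneg (highDensityK_bounds hφ g y).1]) x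

/-! ### The three terms of `W(G₂)` -/

/-- **Prime term.** `‖prime(G₂)‖ ≤ 2 M_φ S(2a + δ)`. -/
theorem norm_weilPrimeTerm_highPartK_le (hg : IsWeilTest g) (hsupp : tsupport g ⊆ Icc (-a) a)
    (hφ : IsSplitKernel φ δ) :
    ‖weilPrimeTerm (highPartK g φ)‖ ≤ 2 * highMassK g φ * primeSum (2 * a + δ) :=
  norm_weilPrimeTerm_le_of_tsupport_subset (isWeilTest_highPartK hg hφ).1.continuous
    (tsupport_highPartK_subset hg hsupp hφ) (norm_highPartK_le hg hφ)

/-- **Polar term with defect `p`.** `‖polar(G₂)‖ ≤ 2 p e^a ‖g‖₁²`. -/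
theorem norm_weilPolarTerm_highPartK_le (hg : IsWeilTest g) (hsupp : tsupport g ⊆ Icc (-a) a)
    (hφ : IsSplitKernel φ δ) {p : ℝ} (hp0 : ‖1 - weilMellin φ 0‖ ≤ p)
    (hp1 : ‖1 - weilMellin φ 1‖ ≤ p) :
    ‖weilPolarTerm (highPartK g φ)‖ ≤ 2 * p * (Real.exp a * weilNorm1 g ^ 2) := by
  unfold weilPolarTerm
  rw [weilMellin_highPartK hg hφ, weilMellin_highPartK hg hφ]
  have hA0 := norm_weilMellin_autoCorr_le hg hsupp (s := 0) (Or.inl rfl)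
  have hA1 := norm_weilMellin_autoCorr_le hg hsupp (s := 1) (Or.inr rfl)
  have hE : 0 ≤ Real.exp a * weilNorm1 g ^ 2 := by positivity
  calc ‖weilMellin (autoCorr g) 0 * (1 - weilMellin φ 0) +
        weilMellin (autoCorr g) 1 * (1 - weilMellin φ 1)‖
      ≤ ‖weilMellin (autoCorr g) 0‖ * ‖1 - weilMellin φ 0‖ +
        ‖weilMellin (autoCorr g) 1‖ * ‖1 - weilMellin φ 1‖ := by
        refine (norm_add_le _ _).trans ?_
        rw [norm_mul, norm_mul]
    _ ≤ (Real.exp a * weilNorm1 g ^ 2) * p + (Real.exp a * weilNorm1 g ^ 2) * p :=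
        add_le_add (mul_le_mul hA0 hp0 (norm_nonneg _) hE) (mul_le_mul hA1 hp1 (norm_nonneg _) hE)
    _ = 2 * p * (Real.exp a * weilNorm1 g ^ 2) := by ring

/-- **Transparency, integrated.** If `1 - Φ(t) ≤ θ` for `|t| < |h|` (`θ ≥ 0`) then
`∫_{|t|<|h|} u ≤ θ · 2π ‖g‖₂²`. -/
theorem setIntegral_highDensityK_le (hg : IsWeilTest g) (hφ : IsSplitKernel φ δ) {h θ : ℝ}
    (hθ0 : 0 ≤ θ) (hθ : ∀ t : ℝ, |t| < |h| → 1 - lineSymbol φ t ≤ θ) :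
    ∫ t in Ioo (-|h|) |h|, highDensityK g φ t ≤ θ * (2 * π * weilNorm2Sq g) := by
  set f : ℝ → ℝ := fun t ↦ ‖weilMellin g (1 / 2 + t * I)‖ ^ 2 with hf
  have hfi : Integrable f := integrable_norm_sq_weilMellin_half_line hg
  have hpt : ∀ t ∈ Ioo (-|h|) |h|, highDensityK g φ t ≤ θ * f t := by
    intro t ht
    have hth : |t| < |h| := abs_lt.2 ⟨ht.1, ht.2⟩
    have h3 := hθ t hth
    unfold highDensityK
    have hf0 : 0 ≤ f t := sq_nonneg _
    calc ‖weilMellin g (1 / 2 + t * I)‖ ^ 2 * (1 - lineSymbol φ t)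
        ≤ f t * θ := mul_le_mul_of_nonneg_left h3 hf0
      _ = θ * f t := by ring
  calc ∫ t in Ioo (-|h|) |h|, highDensityK g φ t
      ≤ ∫ t in Ioo (-|h|) |h|, θ * f t :=
        setIntegral_mono_on (integrable_highDensityK hg hφ).integrableOn
          (hfi.const_mul _).integrableOn measurableSet_Ioo hpt
    _ = θ * ∫ t in Ioo (-|h|) |h|, f t := integral_const_mul _ _
    _ ≤ θ * ∫ t, f t := by
        refine mul_le_mul_of_nonneg_left ?_ hθ0
        exact setIntegral_le_integral hfi (Eventually.of_forall fun t ↦ sq_nonneg _)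
    _ = θ * (2 * π * weilNorm2Sq g) := by
        rw [hf, integral_norm_sq_weilMellin_half_line hg]

/-- **Archimedean integral.** `Re ∫ Ĝ₂ Re ψ = ∫ u Re ψ`. -/
theorem weilArchIntegral_highPartK_re (hg : IsWeilTest g) (hφ : IsSplitKernel φ δ) :
    (weilArchIntegral (highPartK g φ)).re = ∫ t, highDensityK g φ t * reDigammaQuarter t := by
  unfold weilArchIntegral
  have e : (fun t : ℝ ↦ weilMellin (highPartK g φ) (1 / 2 + t * I) *
      ((Complex.digamma (1 / 4 + t / 2 * I)).re : ℂ)) =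
      fun t : ℝ ↦ ((highDensityK g φ t * reDigammaQuarter t : ℝ) : ℂ) := by
    funext t
    rw [weilMellin_highPartK_half_line hg hφ, reDigammaQuarter]
    push_cast; ring
  rw [e, integral_complex_ofReal, Complex.ofReal_re]

/-- **High part with margin, general kernel.** If `log π + 2 S(2a + δ) + c ≤ Re ψ(1/4 + ih/2)`,
transparency `θ` holds on `|t| < |h|` and the polar defect is `≤ p`, then
`Re W(G₂) ≥ c · M_φ(g) - (W_h - W_0) θ ‖g‖₂² - 2 p e^a ‖g‖₁²`. No hypothesis on the zeros. -/
theorem weilFunctional_highPartK_re_ge (hg : IsWeilTest g) (hsupp : tsupport g ⊆ Icc (-a) a)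
    (hφ : IsSplitKernel φ δ) {h c θ p : ℝ} (hθ0 : 0 ≤ θ)
    (hθ : ∀ t : ℝ, |t| < |h| → 1 - lineSymbol φ t ≤ θ)
    (hp0 : ‖1 - weilMellin φ 0‖ ≤ p) (hp1 : ‖1 - weilMellin φ 1‖ ≤ p)
    (hh : Real.log π + 2 * primeSum (2 * a + δ) + c ≤ reDigammaQuarter h) :
    c * highMassK g φ - (reDigammaQuarter h - reDigammaQuarter 0) * θ * weilNorm2Sq g
        - 2 * p * (Real.exp a * weilNorm1 g ^ 2) ≤ (weilFunctional (highPartK g φ)).re := by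
  set G := highPartK g φ with hG
  set M₂ := highMassK g φ with hM₂
  set W := reDigammaQuarter h
  set w₀ := reDigammaQuarter 0
  have hM₂0 : 0 ≤ M₂ := highMassK_nonneg hφ g
  have hπ : (0 : ℝ) < 2 * π := by positivity
  have hpol : -(2 * p * (Real.exp a * weilNorm1 g ^ 2)) ≤ (weilPolarTerm G).re := by
    have h1 := norm_weilPolarTerm_highPartK_le hg hsupp hφ hp0 hp1
    have h2 := neg_le_abs (weilPolarTerm G).re
    have h3 := Complex.abs_re_le_norm (weilPolarTerm G)
    linarith
  have hpri : (weilPrimeTerm G).re ≤ 2 * M₂ * primeSum (2 * a + δ) := by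
    have h1 := norm_weilPrimeTerm_highPartK_le hg hsupp hφ
    exact ((Complex.re_le_norm _)).trans h1
  have hstep := integral_mul_reDigammaQuarter_ge_step (fun t ↦ (highDensityK_bounds hφ g t).1)
    (integrable_highDensityK hg hφ) (integrable_highDensityK_mul_reDigammaQuarter hg hφ) h
  have hlow := setIntegral_highDensityK_le hg hφ hθ0 hθ
  have hWw : 0 ≤ W - w₀ := by linarith [reDigammaQuarter_zero_le h]
  have hint : ∫ t, highDensityK g φ t = 2 * π * M₂ := by
    rw [hM₂, highMassK, ← mul_assoc, mul_inv_cancel₀ hπ.ne', one_mul]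
  have harchI : 2 * π * (W * M₂ - (W - w₀) * θ * weilNorm2Sq g) ≤
      (weilArchIntegral G).re := by
    rw [weilArchIntegral_highPartK_re hg hφ]
    have : (W - w₀) * (∫ t in Ioo (-|h|) |h|, highDensityK g φ t) ≤
        (W - w₀) * (θ * (2 * π * weilNorm2Sq g)) :=
      mul_le_mul_of_nonneg_left hlow hWw
    rw [hint] at hstep
    linarith
  have hG0 : (G 0 * (Real.log π : ℂ)).re ≤ M₂ * Real.log π := by
    rw [Complex.re_mul_ofReal]
    refine mul_le_mul_of_nonneg_right ?_ (Real.log_nonneg (by linarith [Real.pi_gt_three]))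
    exact (Complex.re_le_norm _).trans (norm_highPartK_le hg hφ 0)
  have harch : W * M₂ - (W - w₀) * θ * weilNorm2Sq g - M₂ * Real.log π ≤
      (weilArchTerm G).re := by
    unfold weilArchTerm
    rw [Complex.sub_re]
    have e : ((1 / (2 * π) : ℂ) * weilArchIntegral G).re = 1 / (2 * π) * (weilArchIntegral G).re := by
      have : (1 / (2 * π) : ℂ) = ((1 / (2 * π) : ℝ) : ℂ) := by push_cast; ring
      rw [this, Complex.re_ofReal_mul]
    rw [e]
    have h3 : W * M₂ - (W - w₀) * θ * weilNorm2Sq g ≤ 1 / (2 * π) * (weilArchIntegral G).re := by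
      rw [one_div, le_inv_mul_iff₀ hπ]; exact harchI
    linarith
  have hW : weilFunctional G = weilPolarTerm G - weilPrimeTerm G + weilArchTerm G := rfl
  rw [hW, Complex.add_re, Complex.sub_re]
  have hkey : c * M₂ ≤ M₂ * (W - Real.log π - 2 * primeSum (2 * a + δ)) := by
    have : c ≤ W - Real.log π - 2 * primeSum (2 * a + δ) := by linarith
    nlinarith
  nlinarith [hpol, hpri, harch, hkey]

end Summit.RiemannHypothesis.RiemannHypothesis.Theorems
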